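import Summits.BirchSwinnertonDyer.Rank1Residual.X12.O11.RamifiedRubinFormulaLine
import Summits.BirchSwinnertonDyer.BirchSwinnertonDyer.Theorems.RamifiedSevenEllipticUnitsValueIffBsdpAnyPrime
import HarnessLib

set_option linter.dupNamespace false

/-!
# Route `RamifiedSevenEllipticUnits` (K7r), value child `EllipticUnitValueSeven`
# (stmt-BirchSwinnertonDyer-19705), line `rubin-formula`: the open stub `S_open`
# (`X12.O11.RamifiedCMRubinFormulaAt W p`) is EQUIVALENT to the value law
# `X12.O11.RamifiedCMBottomClassIndexLawAt W p` modulo the two decidable stubs `S_dict`, `S_B4`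
# — hence to `BSD(W, p)` modulo (R-IMC)∃ and the four named facts — at every CM-ramified prime

Cell `bsd-cm`, seat `bsd-cm-ram` g8 (the holder of `stub_rubinFormulaSeven`). HONEST FRAMING: nothing
here closes an item and BSD is not proved; this file records, in the kernel, WHERE the research content
of the δ-line sits.

k7r-c3's line file `X12/O11/RamifiedRubinFormulaLine.lean` proves the composition
`S_dict → S_B4 → S_open → RamifiedCMBottomClassIndexLawAt W p`. Here we prove the CONVERSE seam
`RamifiedCMBottomClassIndexLawAt W p → S_dict → S_B4 → S_open` (uniqueness of the local index exponent
`λ₀`, `EllipticUnitClassData.hasLocalBottomIndexExp_unique`), hence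

* `ramifiedCMRubinFormulaAt_iff_indexLawAt` — `S_dict → S_B4 → (S_open ↔ (R-PR)|IMC)`: the line
  `rubin-formula` RESTATES the value child in `λ₀`-language; it does not cut it. Its only research
  stub IS the crux (modulo two M-sized dictionary statements about the Mordell–Weil lattice at `𝔭`).
* `ramifiedCMRubinFormulaAt_of_bsdp` — `BSD(W, p)` ∧ `S_dict` ∧ `S_B4` ⟹ `S_open` at analytic rank `≤ 1`
  (through k7r-c4's `ramifiedCMBottomClassIndexLawAt_of_bsdp`; facts: Cassels, modularity, GZK);
  `ramifiedCMRubinFormulaAt_iff_bsdp_of_imc` — `S_open ↔ BSD(W, p)` modulo `S_dict`, `S_B4`, (R-IMC)∃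
  and {modularity, GZ I.(7.3), GZK, Cassels}, at analytic rank one, `p ≥ 5` CM-ramified.
* Route level (𝒞₇, `p = 7`): `rubinFormulaSeven_iff_ellipticUnitValueSeven` — the registered stub
  statements `stub_localMordellWeilDictSeven` ∧ `stub_bottomLocalIndexSplitSeven` turn
  `stub_rubinFormulaSeven`'s statement into the route item `EllipticUnitValueSeven` AND BACK; and
  `rubinFormulaSeven_of_bsdpOnClassCSeven` — wherever `BSD(·, 7)` is certified on 𝒞₇ (Route U's unit
  case, per member) the open stub's conclusion holds there, given the two dictionary stubs.

Consequence for the programme (memo `pub/bsd-cm/bsd-cm-ram/g8/DESCENT-ANATOMY-ram-g8.md`): the value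
child carries exactly ONE transcendental identity — `ord_π ℒ_{p,v_ε}(φ)(𝟙) = 2 m_loc + ord_p(#Ш_an(W)
· #Ш_an(W'))`, i.e. the `π`-adic divisibility index of the bottom elliptic-unit class in `E(K) ⊗ ℤ_p`
equals `m_loc + ord_p(#Ш_an(W) #Ш_an(W'))` — and no reformulation inside the tree's present vocabulary
makes it smaller. References: [BurungaleKobayashiNakamuraOta2026] §1.4, Thm. 3.14 (3), Thm. 7.2
(arXiv:2608.06879; shape only); [Miller2011LMS] Def. 1.1; [Cassels1965ArithmeticVIII].
-/

noncomputable section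

open scoped Classical

open WeierstrassCurve NumberField IsDedekindDomain Field
  Literature.NumberTheory.EllipticCurves
  Literature.NumberTheory.EllipticCurves.Rank1Residual
  Literature.NumberTheory.EllipticCurves.BurungaleKobayashiNakamuraOta2026
  Literature.NumberTheory.GaloisRepresentations
  Summit.BirchSwinnertonDyer.Rank1Residual.Additive

namespace Summit.BirchSwinnertonDyer.BirchSwinnertonDyer.Theorems.RamifiedSevenEllipticUnits

open Summit.BirchSwinnertonDyer.Rank1Residual Summit.BirchSwinnertonDyer.Rank1Residual.X12.O11
  Summit.BirchSwinnertonDyer.BirchSwinnertonDyer.Theses.RamifiedSevenEllipticUnits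

section AnyPrime

variable {W : WeierstrassCurve ℚ} [W.IsElliptic] [W.IsGloballyMinimal] {p : ℕ} [Fact p.Prime]

omit [W.IsGloballyMinimal] in
/-- **The converse seam of the δ-line: (R-PR)|IMC ∧ `S_dict` ∧ `S_B4` ⟹ `S_open`.** Given the datum `D`
with global exponent `c` and the IMC identity at an analytic-rank-one frame, `S_dict` gives
`m_loc = n + n'`, `S_B4` gives `λ₀(D) = c + (n + n')`, the value law gives `c = n + n' + ord_p q + ord_p q'`;
any local exponent `l` of `D` equals `c + (n + n')` by uniqueness of `λ₀`
(`hasLocalBottomIndexExp_unique`), hence `l = 2(n + n') + ord_p q + ord_p q'`. PROVED (linear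
arithmetic). [cite: BurungaleKobayashiNakamuraOta2026, §1.4 and Thm. 7.2 (arXiv:2608.06879 pp. 8, 41) (the objects; shape only)]
[cite: Miller2011LMS, Def. 1.1 (arXiv:1010.2431 p. 3)] -/
theorem ramifiedCMRubinFormulaAt_of_indexLawAt_of_dict_of_split
    (hlaw : RamifiedCMBottomClassIndexLawAt W p) (hdict : RamifiedCMLocalMordellWeilDictAt W p)
    (hsplit : RamifiedCMBottomLocalIndexSplitAt W p) : RamifiedCMRubinFormulaAt W p := by
  intro K _ _ 𝔭 W' _ _ C hF hr κ hκ γ _ P n P' n' hP hgen htors hdiv hndiv hP' hgen' htors' hdiv' hndiv'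
    q q' hq hq' ι φ Ω 𝓔 D c hc himc l hl
  have hm : HasBottomLocalMordellWeilIndexExp W p K 𝔭 κ (n + n') :=
    hdict K 𝔭 W' C hF hr κ hκ P n P' n' hP hgen htors hdiv hndiv hP' hgen' htors' hdiv' hndiv'
  have hl' : D.HasLocalBottomIndexExp (c + (n + n')) :=
    hsplit K 𝔭 W' C hF hr κ hκ γ ι φ Ω 𝓔 D c hc himc (n + n') hm
  have hcl : l = c + (n + n') := D.hasLocalBottomIndexExp_unique hl hl'
  have hval : (c : ℤ) = (n : ℤ) + n' + padicValRat p q + padicValRat p q' :=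
    hlaw K 𝔭 W' C hF hr κ hκ γ P n P' n' hP hgen htors hdiv hndiv hP' hgen' htors' hdiv' hndiv'
      q q' hq hq' ι φ Ω 𝓔 D c hc himc
  subst hcl
  push_cast
  linarith

omit [W.IsGloballyMinimal] in
/-- **`S_open ↔ (R-PR)|IMC` modulo `S_dict` and `S_B4`** (the two directions:
`ramifiedCMBottomClassIndexLawAt_of_dict_of_split_of_rubinFormula`, k7r-c3, and the converse seam
above). The line `rubin-formula` is a RESTATEMENT of the value child in the local index exponent `λ₀`,
not a reduction of it. [cite: BurungaleKobayashiNakamuraOta2026, §1.4 and Thm. 7.2 (arXiv:2608.06879 pp. 8, 41) (shape only)]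
[cite: Miller2011LMS, Def. 1.1 (arXiv:1010.2431 p. 3)] -/
theorem ramifiedCMRubinFormulaAt_iff_indexLawAt (hdict : RamifiedCMLocalMordellWeilDictAt W p)
    (hsplit : RamifiedCMBottomLocalIndexSplitAt W p) :
    RamifiedCMRubinFormulaAt W p ↔ RamifiedCMBottomClassIndexLawAt W p :=
  ⟨ramifiedCMBottomClassIndexLawAt_of_dict_of_split_of_rubinFormula hdict hsplit,
    fun hlaw ↦ ramifiedCMRubinFormulaAt_of_indexLawAt_of_dict_of_split hlaw hdict hsplit⟩

/-- **`BSD(W, p)` ⟹ `S_open`**, granted `S_dict`, `S_B4` and the named facts Cassels, modularity, GZK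
(analytic rank `≤ 1`): k7r-c4's `ramifiedCMBottomClassIndexLawAt_of_bsdp` composed with the converse
seam — NO IMC piece and no elliptic-unit input is needed in this direction. So on every member where
`BSD(W, p)` is certified the analytic ramified Rubin formula `λ₀ = 2(n + n') + ord_p q + ord_p q'` holds
for every datum satisfying the IMC identity (Route U's unit case at `p = 7`: `λ₀ = 0`).
[cite: Miller2011LMS, Def. 1.1 (arXiv:1010.2431 p. 3)] [cite: Cassels1965ArithmeticVIII] -/
theorem ramifiedCMRubinFormulaAt_of_bsdp (hCassels : bsdRHS_eq_of_isIsogenous)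
    (hmod : hasEntireLFunction_rat) (hGZK : rank_eq_analyticRank_of_analyticRank_le_one)
    (hr : W.analyticRank ≤ 1) (hB : BSDp W p) (hdict : RamifiedCMLocalMordellWeilDictAt W p)
    (hsplit : RamifiedCMBottomLocalIndexSplitAt W p) : RamifiedCMRubinFormulaAt W p :=
  ramifiedCMRubinFormulaAt_of_indexLawAt_of_dict_of_split
    (ramifiedCMBottomClassIndexLawAt_of_bsdp hCassels hmod hGZK hr hB) hdict hsplit

/-- **`S_open ↔ BSD(W, p)`** for a globally minimal CM curve of analytic rank one at a CM-ramified prime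
`p ≥ 5`, modulo `S_dict`, `S_B4`, (R-IMC)∃ and the four named facts {modularity, GZ I.(7.3), GZK,
Cassels}: `ramifiedCMRubinFormulaAt_iff_indexLawAt` chained with k7r-c4's
`ramifiedCMBottomClassIndexLawAt_iff_bsdp_of_imc`. The research content of the δ-line's open stub is
EXACTLY the `p`-part of BSD for `W` (⟺ for the frame twin `W' ∼ W`, Cassels).
[cite: Miller2011LMS, Def. 1.1 (arXiv:1010.2431 p. 3)]
[cite: BurungaleKobayashiNakamuraOta2026, Thm. 3.14 (3) and §1.4 (arXiv:2608.06879; shape only)] -/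
theorem ramifiedCMRubinFormulaAt_iff_bsdp_of_imc (hmod : hasEntireLFunction_rat)
    (hGZ : GrossZagier1986_thm_I_7_3) (hGZK : rank_eq_analyticRank_of_analyticRank_le_one)
    (hCassels : bsdRHS_eq_of_isIsogenous) (h1 : RamifiedCMEllipticUnitIMCAt W p) (hCM : W.HasCM)
    (hram : CMRamified W p) (h5 : 5 ≤ p) (hr : W.analyticRank = 1)
    (hdict : RamifiedCMLocalMordellWeilDictAt W p) (hsplit : RamifiedCMBottomLocalIndexSplitAt W p) :
    RamifiedCMRubinFormulaAt W p ↔ BSDp W p :=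
  (ramifiedCMRubinFormulaAt_iff_indexLawAt hdict hsplit).trans
    (ramifiedCMBottomClassIndexLawAt_iff_bsdp_of_imc hmod hGZ hGZK hCassels h1 hCM hram h5 hr)

end AnyPrime

section ClassCSeven

/-- **Route level, 𝒞₇ at `p = 7`: the registered stub statements `stub_localMordellWeilDictSeven` and
`stub_bottomLocalIndexSplitSeven` make `stub_rubinFormulaSeven`'s statement EQUIVALENT to the route item
`EllipticUnitValueSeven` (stmt-BirchSwinnertonDyer-19705).** Pointwise in `W` by
`ramifiedCMRubinFormulaAt_iff_indexLawAt`. [cite: Miller2011LMS, Def. 1.1 (arXiv:1010.2431 p. 3)] -/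
theorem rubinFormulaSeven_iff_ellipticUnitValueSeven
    (hdict : ∀ (W : WeierstrassCurve ℚ) [W.IsElliptic] [W.IsGloballyMinimal] [Fact (Nat.Prime 7)],
      X12.ClassCSeven W → RamifiedCMLocalMordellWeilDictAt W 7)
    (hsplit : ∀ (W : WeierstrassCurve ℚ) [W.IsElliptic] [W.IsGloballyMinimal] [Fact (Nat.Prime 7)],
      X12.ClassCSeven W → RamifiedCMBottomLocalIndexSplitAt W 7) :
    (∀ (W : WeierstrassCurve ℚ) [W.IsElliptic] [W.IsGloballyMinimal] [Fact (Nat.Prime 7)],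
        X12.ClassCSeven W → RamifiedCMRubinFormulaAt W 7) ↔ EllipticUnitValueSeven :=
  ⟨fun h W _ _ _ hW ↦ (ramifiedCMRubinFormulaAt_iff_indexLawAt (hdict W hW) (hsplit W hW)).1 (h W hW),
    fun h W _ _ _ hW ↦ (ramifiedCMRubinFormulaAt_iff_indexLawAt (hdict W hW) (hsplit W hW)).2 (h W hW)⟩

/-- **`BSD(·, 7)` on 𝒞₇ ⟹ the open stub's statement on 𝒞₇**, given the two dictionary stubs and the
named facts Cassels, modularity, GZK (analytic rank one is part of `ClassCSeven`). So the δ-line's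
research stub cannot fail at a member where `BSD(W, 7)` is certified (Route U's 25 unit-case classes of
conductor `< 5·10⁵`, per member, modulo Route U's print binders) unless `S_dict` or `S_B4` fails there.
[cite: Miller2011LMS, Def. 1.1 (arXiv:1010.2431 p. 3)] [cite: Cassels1965ArithmeticVIII] -/
theorem rubinFormulaSeven_of_bsdpOnClassCSeven (hCassels : bsdRHS_eq_of_isIsogenous)
    (hmod : hasEntireLFunction_rat) (hGZK : rank_eq_analyticRank_of_analyticRank_le_one)
    (hB : ∀ (W : WeierstrassCurve ℚ) [W.IsElliptic] [W.IsGloballyMinimal] [Fact (Nat.Prime 7)],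
      X12.ClassCSeven W → BSDp W 7)
    (hdict : ∀ (W : WeierstrassCurve ℚ) [W.IsElliptic] [W.IsGloballyMinimal] [Fact (Nat.Prime 7)],
      X12.ClassCSeven W → RamifiedCMLocalMordellWeilDictAt W 7)
    (hsplit : ∀ (W : WeierstrassCurve ℚ) [W.IsElliptic] [W.IsGloballyMinimal] [Fact (Nat.Prime 7)],
      X12.ClassCSeven W → RamifiedCMBottomLocalIndexSplitAt W 7) :
    ∀ (W : WeierstrassCurve ℚ) [W.IsElliptic] [W.IsGloballyMinimal] [Fact (Nat.Prime 7)],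
      X12.ClassCSeven W → RamifiedCMRubinFormulaAt W 7 :=
  fun W _ _ _ hW ↦ ramifiedCMRubinFormulaAt_of_bsdp hCassels hmod hGZK (le_of_eq hW.2.2.1) (hB W hW)
    (hdict W hW) (hsplit W hW)

end ClassCSeven

end Summit.BirchSwinnertonDyer.BirchSwinnertonDyer.Theorems.RamifiedSevenEllipticUnits

end
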